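import Summits.Ventures.YMGap.RobustBall.IsingBallD3Layer
import Summits.Ventures.YMGap.RobustBall.CentreBlindBallWindow
import HarnessLib

/-!
# RobustBall/CentreBlindBallWindowD3 — THE BALL WINDOW IN `d = 3` (rung 3 of the `β`-ladder): `AreaLawCentreBlind 2 3 β` for `SU(2)` whenever
# `tanh β_W ≤ 6/19`, i.e. `β_W ≤ artanh(6/19) = 0.32696…` (rung 2, stars: `β_W < 0.29706`; rung 1, Dobrushin: `β_W < 1/4`)

HONEST FRAMING: venture file of the cell `pub-ymgap` (QuantumFields programme), track Y2 ROBUST-BALL / DS seat ds-4 (g10; filed by g13 without the star-containment corollary); the `d = 3` twin of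
`CentreBlindBallWindow`.  WHAT THIS IS: a strong-coupling LATTICE theorem — Wilson's area law with ONE pair `(C, c)` on every torus `(ℤ/L)^3`, for `SU(2)`
and EVERY LINKWISE CENTRE-BLIND perturbation (gen 7's countersigned currency `AreaLawCentreBlind 2 3 β`), for every tree coupling with
`tanh(2|β|) ≤ 6/19` (`β_W = 2|β| ≤ 0.326962…`).  MECHANISM: as in `d = 4` — centre projection, block conditioning, the `ℤ₂` layer as an Ising model
on the (here two-dimensional) layer graph bounded by the ferromagnet, and the Simon–Lieb inequality with the 13-site `ℓ¹`-balls of radius 2 of `ℤ²`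
as sets, whose certificate `φ_β(B₂) ≤ 0.996998 < 1` on `[0, artanh(6/19)]` is a KERNEL COMPUTATION (`IsingBallD3`: 32-term integer core sum;
`IsingBallD3Bound`: heat bath + Griffiths monotonicity; `IsingBallD3Embed/Layer`: transport, `L ≥ 6`); `L ≤ 5` trivial.
**`su2_areaLawCentreBlind_ball2_dim3`**; cells `β_W = 0.3` (`AreaLawCentreBlind 2 3 (3/20)`) and `β_W = 0.32` (`AreaLawCentreBlind 2 3 (4/25)`); the
limit-state reading.  HONEST LABEL: `SU(2)`, `d = 3`, centre-blind class only; the ladder's ceiling is `β_c(ℤ² Ising) = ½ log(1+√2) = 0.4407` and the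
class deconfines only at the `ℤ₂`-gauge transition; the root of `φ(B₂) = 1` is `β_W ≈ 0.3273`, so rung 3 is exhausted; rate a door artefact; nothing
continuum / spectral / Clay.

References AS PRINTED: J. Fröhlich, Phys. Lett. B 83 (1979) 195; G. Mack, V. B. Petkova, Ann. Phys. 123 (1979) 442; B. Simon, Comm. Math. Phys. 77
(1980) 111; E. Lieb, Comm. Math. Phys. 77 (1980) 127; H. Duminil-Copin, V. Tassion, Comm. Math. Phys. 343 (2016) 725, Lemma 2.7; R. Griffiths,
J. Math. Phys. 8 (1967) 478.
-/

noncomputable section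

open Finset MeasureTheory
open Literature.MathematicalPhysics.QuantumLattice (fundamentalRep)
open Literature.MathematicalPhysics.QuantumFieldTheory

namespace Summit.Ventures.YMGap.RobustBall

namespace BallD3

open ZN ZNFluxW ZTwo

variable {L : ℕ} [NeZero L]

/-! ### From a boundary-sum bound on `[0, β₁]` to the area law (certificate → row) -/

section Cert

variable {β₁ B : ℝ}
  (hB : ∀ β : ℝ, 0 ≤ β → β ≤ β₁ →
    3 * ∑ ks : Fin 2 × Bool, Literature.Probability.LatticeModels.isingTwoPoint graph Finset.univ β 0 .free V.centre (V.axis ks.1 ks.2) +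
      2 * ∑ c : Bool × Bool, Literature.Probability.LatticeModels.isingTwoPoint graph Finset.univ β 0 .free V.centre (V.corner c.1 c.2) ≤ B)

include hB

/-- **TWO-POINT BOUND OF THE CENTRE-PROJECTED `ℤ₂` LAYER FROM A BALL CERTIFICATE** (`d = 3`, `L ≥ 6`, no twist defect, `2|β| ≤ β₁`):
`‖E ψ₂(σ_b − σ_t)‖ ≤ (tanh β₁ · B)^{⌊dist_j(t,b)/3⌋}`. [folklore] -/
theorem norm_cavg_ψ_two_le_ballCert_pow (hL : 6 ≤ L) {β : ℝ} (hβ : 2 * |β| ≤ β₁)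
    (gD : Fin 0 → (Plaquette 3 L → ZMod 2) → GaugeConfig 3 L (SUN 2) → ℝ) (U : GaugeConfig 3 L (SUN 2)) (i j : Fin 3)
    (H : Finset (ZMod L)) (kT : Transverse 3 L (ZMod 2) i) (κ : Site 3 L → ZMod 2) (b t : Site 3 L) :
    ‖FiniteGibbs.cavg (layerWeightW (gS β gD U) i H kT κ) (fun σ => ψ 2 (σ b - σ t))‖ ≤ (Real.tanh β₁ * B) ^ (jDist j t b / 3) := by
  classical
  refine (norm_cavg_ψ_two_le_gksExpect_const (by omega) β gD U i H kT κ b t).trans ?_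
  rw [gksExpect_const_eq_isingTwoPoint (by omega)]
  exact isingTwoPoint_layer_le_pow_of hL hB (by positivity) hβ i j H t b

/-- **The induced `ℤ₂` Wilson loop obeys the ball-certificate bound** (`d = 3`, `L ≥ 6`, `i ≠ j`, `2R, 2T ≤ L`). [folklore] -/
theorem norm_znLoopW_le_ballCert (hL : 6 ≤ L) {β : ℝ} (hβ : 2 * |β| ≤ β₁)
    (gD : Fin 0 → (Plaquette 3 L → ZMod 2) → GaugeConfig 3 L (SUN 2) → ℝ) (U : GaugeConfig 3 L (SUN 2)) (x : Site 3 L) {i j : Fin 3}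
    (hij : i ≠ j) {R T : ℕ} (hR : 2 * R ≤ L) (hT : 2 * T ≤ L) :
    ‖znLoopW β gD U x i j R T‖ ≤ ((Real.tanh β₁ * B) ^ (T / 3)) ^ (selIdx 1 R).card := by
  classical
  unfold znLoopW
  refine norm_cavg_ψ_loopSum_le_of_bound (supp := suppS (fun _ : Fin 0 => (∅ : Finset (Plaquette 3 L)))) (g := gS β gD U)
    ?_ hij (m := 1) ?_ (F := fun D => (Real.tanh β₁ * B) ^ (D / 3)) (fun H kT κ b t => ?_) x hR hT
  · rintro (p | t)
    · intro φ φ' h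
      simp only [gS, Sum.elim_inl]
      rw [h p (by simp [suppS])]
    · exact Fin.elim0 t
  · rintro (p | t) y hy y' hy'
    · simp only [suppS, Sum.elim_inl, iLinks_singleton] at hy hy'
      rw [iDist_eq_zero_of_mem_iSites i p hy hy']; exact Nat.one_pos
    · exact Fin.elim0 t
  · exact norm_cavg_ψ_two_le_ballCert_pow hB hL hβ gD U i j H kT κ b t

/-- **CENTRE PROJECTION + BALL CERTIFICATE** (`SU(2)`, `d = 3`, `L ≥ 6`). [cite: Frohlich1979ZN, Eq. (7)–(9)] -/
theorem abs_wilsonLoop_le_ballCert (hL : 6 ≤ L) {β : ℝ} (hβ : 2 * |β| ≤ β₁) (W : Perturbation 3 L 2) (hW : IsTwistBlind W) (x : Site 3 L)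
    {i j : Fin 3} (hij : i ≠ j) {R T : ℕ} (hR : 2 * R ≤ L) (hT : 2 * T ≤ L) :
    |W.expectation (fundamentalRep (Fin 2)) β (wilsonLoop (fundamentalRep (Fin 2)) x i j R T)| ≤
      ((Real.tanh β₁ * B) ^ (T / 3)) ^ (selIdx 1 R).card :=
  abs_expectation_wilsonLoop_le_of_fluxDefect W (c := W.total) (gD := fun (_ : Fin 0) _ _ => (0 : ℝ))
    (fun k U => by rw [hW k U]; simp) β x i j R T fun U => norm_znLoopW_le_ballCert hB hL hβ _ U x hij hR hT

end Cert

/-- **CERTIFICATE → ROW (`d = 3`): `AreaLawCentreBlind 2 3 β` from a boundary-sum bound** with `0 < tanh β₁ · B < 1`, for `2|β| ≤ β₁`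
(`C = e^c`, `c = −log(tanh β₁ · B)/3`). [cite: MackPetkova1979, §2] -/
theorem su2_areaLawCentreBlind_of_ballCert {β₁ B : ℝ}
    (hB : ∀ β : ℝ, 0 ≤ β → β ≤ β₁ →
      3 * ∑ ks : Fin 2 × Bool, Literature.Probability.LatticeModels.isingTwoPoint graph Finset.univ β 0 .free V.centre (V.axis ks.1 ks.2) +
        2 * ∑ c : Bool × Bool, Literature.Probability.LatticeModels.isingTwoPoint graph Finset.univ β 0 .free V.centre (V.corner c.1 c.2) ≤ B)
    (hφ0 : 0 < Real.tanh β₁ * B) (hφ1 : Real.tanh β₁ * B < 1) {β : ℝ} (hβ : 2 * |β| ≤ β₁) : AreaLawCentreBlind 2 3 β := by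
  set φ := Real.tanh β₁ * B with hφ
  set c := -Real.log φ / 3 with hc
  have hcpos : 0 < c := div_pos (neg_pos.2 (Real.log_neg hφ0 hφ1)) (by norm_num)
  set C := Real.exp c with hC
  refine ⟨C, c, hcpos, fun L _ W hW x i j R T hij hR1 hT1 hRL hTL => ?_⟩
  have hWt : IsTwistBlind W := hW.isTwistBlind
  by_cases hL : 6 ≤ L
  · refine (abs_wilsonLoop_le_ballCert hB hL hβ W hWt x hij hRL hTL).trans ?_
    have h2 : (φ ^ (T / 3)) ^ (selIdx 1 R).card ≤ (φ ^ (T / 3)) ^ R :=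
      pow_le_pow_of_le_one (pow_nonneg hφ0.le _) (pow_le_one₀ hφ0.le hφ1.le) (by simpa using le_mul_card_selIdx Nat.one_pos R)
    refine h2.trans ?_
    have h3 := ballShape hφ0 hφ1.le R T
    rw [← hc] at h3
    exact h3
  · have hR : R ≤ 2 := by omega
    have hT : T ≤ 2 := by omega
    refine (abs_expectation_wilsonLoop_le_one W β x i j R T).trans ?_
    rw [hC, ← Real.exp_nat_mul, ← Real.exp_add]
    refine Real.one_le_exp ?_
    push_cast
    have hR' : (R : ℝ) ≤ 2 := by exact_mod_cast hR
    have hT' : (T : ℝ) ≤ 2 := by exact_mod_cast hT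
    have hR0 : (0 : ℝ) ≤ R := Nat.cast_nonneg R
    have hT0 : (0 : ℝ) ≤ T := Nat.cast_nonneg T
    nlinarith [mul_nonneg hcpos.le hR0, mul_nonneg hcpos.le hT0, mul_nonneg (mul_nonneg hcpos.le hR0) (sub_nonneg.2 hT')]

/-! ### The window, rows and cells -/

/-- **THE `d = 3` BALL WINDOW: `AreaLawCentreBlind 2 3 β` whenever `tanh(2|β|) ≤ 6/19`** (`β_W ≤ artanh(6/19) = 0.326962…`; rate `0.996998…`).
[cite: MackPetkova1979, §2] -/
theorem su2_areaLawCentreBlind_ball2_dim3 {β : ℝ} (hβ : Real.tanh (2 * |β|) ≤ 6 / 19) : AreaLawCentreBlind 2 3 β := by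
  have h := Real.artanh_le_artanh (Real.neg_one_lt_tanh (2 * |β|)) (by norm_num : (6 / 19 : ℝ) < 1) hβ
  rw [Real.artanh_tanh] at h
  refine su2_areaLawCentreBlind_of_ballCert (β₁ := beta3) (B := bound3) (fun β h0 hβ => boundarySum_le h0 hβ) ?_ ?_ h
  · rw [tanh_beta3]; exact rate3_pos
  · rw [tanh_beta3]; exact rate3_lt_one

-- (The containment corollary «rung 3 contains rung 2» is omitted: its statement coincides with the tree's
-- `su2_areaLawCentreBlind_star_dim3` (`CentreBlindStarWindow`), which it would merely restate.)

/-- **CELL SU(2), `d = 3`, `β_W = 3/10`** (beyond the star window `β_W < 0.29706`): `AreaLawCentreBlind 2 3 (3/20)` (`tanh x ≤ x`, `0.3 ≤ 6/19`).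
[folklore] -/
theorem su2_areaLawCentreBlind_ball2_dim3_cell : AreaLawCentreBlind 2 3 (3 / 20) := by
  refine su2_areaLawCentreBlind_ball2_dim3 ?_
  rw [abs_of_pos (by norm_num)]
  exact (Literature.Barriers.HubbardSuperconductivity.tanh_le_self (by norm_num)).trans (by norm_num)

/-- **SHARPER CELL SU(2), `d = 3`, `β_W = 8/25 = 0.32`**: `AreaLawCentreBlind 2 3 (4/25)` via the quintic enclosure of `tanh`
(`tanh 0.32 ≤ 0.30953 ≤ 6/19 = 0.31578…`). [folklore] -/
theorem su2_areaLawCentreBlind_ball2_dim3_cell_sharp : AreaLawCentreBlind 2 3 (4 / 25) := by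
  refine su2_areaLawCentreBlind_ball2_dim3 ?_
  have hx : (2 * |(4 / 25 : ℝ)|) = 8 / 25 := by rw [abs_of_pos (by norm_num)]; norm_num
  rw [hx]
  have hp : Real.tanh (8 / 25 : ℝ) ≤ 8 / 25 - (8 / 25 : ℝ) ^ 3 / 3 + 2 / 15 * (8 / 25 : ℝ) ^ 5 :=
    (Literature.ComputerArithmetic.DeDinechinLauterMullerTorres2013.tanh_quintic_bounds (by norm_num) (by norm_num)).2
  have hnum : 8 / 25 - (8 / 25 : ℝ) ^ 3 / 3 + 2 / 15 * (8 / 25 : ℝ) ^ 5 ≤ 6 / 19 := by norm_num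
  exact hp.trans hnum

/-- **STRING TENSION IN THE `d = 3` BALL WINDOW** (`SU(2)`, `tanh(2|β|) ≤ 6/19`): ONE pair `(C, c)`, `c > 0`, for every infinite-volume limit state of
every eventually-centre-blind family: `HasAreaLawWith μ χ₂ C c`, `HasAreaLawState`, `σ ≥ c` WHENEVER the string tension exists, and `IsConfining`
given existence.  Existence of `σ` NOT asserted. [folklore] -/
theorem su2_stringTension_centreBlind_ball2_dim3 {β : ℝ} (hβ : Real.tanh (2 * |β|) ≤ 6 / 19) :
    ∃ C c : ℝ, 0 < c ∧ ∀ 𝓦 : PerturbationFamily 3 2,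
      (∀ᶠ L : ℕ in Filter.atTop, IsCentreBlind (𝓦 L)) →
        ∀ μ ∈ perturbedLimitPoints β 𝓦,
          Literature.MathematicalPhysics.QuantumLattice.HasAreaLawWith μ (fun g => Literature.MathematicalPhysics.QuantumLattice.normalisedCharacter 2 (fundamentalRep (Fin 2) g)) C c ∧
          Literature.MathematicalPhysics.QuantumLattice.HasAreaLawState μ (fun g => Literature.MathematicalPhysics.QuantumLattice.normalisedCharacter 2 (fundamentalRep (Fin 2) g)) ∧
          (∀ σ : ℝ, Literature.MathematicalPhysics.QuantumLattice.HasStringTension μ (fun g => Literature.MathematicalPhysics.QuantumLattice.normalisedCharacter 2 (fundamentalRep (Fin 2) g)) σ →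
            c ≤ σ) ∧
          ((∃ σ : ℝ, Literature.MathematicalPhysics.QuantumLattice.HasStringTension μ (fun g => Literature.MathematicalPhysics.QuantumLattice.normalisedCharacter 2 (fundamentalRep (Fin 2) g)) σ) →
            Literature.MathematicalPhysics.QuantumLattice.IsConfining μ (fun g => Literature.MathematicalPhysics.QuantumLattice.normalisedCharacter 2 (fundamentalRep (Fin 2) g))) :=
  stringTension_centreBlind (N := 2) (by norm_num) (su2_areaLawCentreBlind_ball2_dim3 hβ)

end BallD3

end Summit.Ventures.YMGap.RobustBall

end
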